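import Literature.NumberTheory.EllipticCurves.Hsieh2012.NonvanishingHeckeLValuesModPCongruentTwist
import Literature.NumberTheory.EllipticCurves.Hsieh2012.NonvanishingHeckeLValuesModPContinuationProofs
import Literature.NumberTheory.EllipticCurves.HeckeGrossencharakterFunctionalEquation
import Literature.NumberTheory.GaloisRepresentations.HeckeLFunctionNonvanishingLineProofs
import Literature.NumberTheory.GaloisRepresentations.HeckeCharacterNormCharacter
import HarnessLib

/-!
# Hsieh 2012 (Amer. J. Math. 134), Remark 6.9 (2) — bookkeeping for the statement file
# `NonvanishingHeckeLValuesModPCongruentTwist.lean`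

Proof file (theorems only, no new definition, no named fact, nothing asserted beyond what is
proved): the general root-number predicate `IsRootNumber κ χ W` of the statement file versus the
sibling's self-dual one —
* for a SELF-DUAL `χ` (`χ·(χ∘c) = ‖·‖`): `χ⁻¹ = (χ∘c)·‖·‖⁻¹`, hence `L(s + ½, χ⁻¹) = L(s − ½, χ)`
  (the dual `L`-function `L(s, χ̄*)` is `L(s, χ*)`; unconditional Euler products, the tree's
  `heckeLFunction_galConj` and `heckeLFunction_mul_eq_of_forall_apply_eq_cpow`), and so
  `IsRootNumber κ χ W ↔ IsSelfDualRootNumber κ χ W` (`Λ′ = Λ` by the identity theorem);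
* the (Rm)-data give an entire continuation of `L(s, χ)` (as the (R)-data do, sibling
  `IsSelfDualRootNumber.hasEntireContinuation`);
* Remark 6.9 (2) with `ν = 1` is Theorem 6.8 as typed (`thmA_of_rem69_2`).
BSD is not touched; item 21341 is not closed by this.

References: [Hsieh2012] M.-L. Hsieh, Amer. J. Math. 134 (2012) = arXiv:1208.4751, Rem. 6.9 (2)
(p. 24), Thm. 6.8 (p. 23), Lemma 6.6 (p. 22), §4.1; [TateThesis1967] Thm. 4.4.1.
-/

noncomputable section

open scoped Classical Topology
open NumberField IsDedekindDomain Complex Filter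
open Literature.NumberTheory.GaloisRepresentations

namespace Literature.NumberTheory.EllipticCurves.Hsieh2012

/-! ### §12. Self-dual characters: the dual `L`-function is the `L`-function -/

section SelfDual

variable {K : Type} [Field K] [NumberField K]

/-- For a self-dual `χ` (`χ·(χ∘c) = ‖·‖`): `χ⁻¹ = (χ ∘ c) · ‖·‖⁻¹`. [cite: Hsieh2012, p. 2 (self-dual: `χ|_{𝔸_F^×} = τ_{K/F}|·|_{𝔸_F}`)] -/
theorem IsSelfDual.inv_eq [IsCMField K] {χ : HeckeCharacter K} (h : IsSelfDual χ) :
    χ⁻¹ = HeckeCharacter.galConj (IsCMField.complexConj K) χ *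
      (HeckeCharacter.normCharacter K)⁻¹ := by
  have h' : χ * HeckeCharacter.galConj (IsCMField.complexConj K) χ =
      HeckeCharacter.normCharacter K := h
  rw [eq_mul_inv_iff_mul_eq, ← h', inv_mul_cancel_left]

/-- For a self-dual `χ`: `L(s + ½, χ⁻¹) = L(s − ½, χ)` for all `s` (`χ⁻¹ = (χ∘c)‖·‖⁻¹`,
`L(s, ψ‖·‖⁻¹) = L(s − 1, ψ)`, `L(s, χ∘c) = L(s, χ)`; identities of unconditional Euler products) —
i.e. `L(s, χ̄*) = L(s, χ*)`: the dual `L`-function of a self-dual character is itself.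
[cite: Hsieh2012, §6.3 (p. 22: "self-dual character, i.e. `χ|_{𝔸_F} = τ_{K/F}|·|_{𝔸_F}`") and Lemma 6.6] -/
theorem IsSelfDual.heckeLFunction_inv_add_half [IsCMField K] {χ : HeckeCharacter K}
    (h : IsSelfDual χ) (s : ℂ) :
    heckeLFunction χ⁻¹ (s + 1 / 2) = heckeLFunction χ (s - 1 / 2) := by
  have hn : ∀ x : ideleGroup K, (((HeckeCharacter.normCharacter K)⁻¹ x : ℂˣ) : ℂ) =
      ((ideleNorm x : ℝ) : ℂ) ^ (-1 : ℂ) := by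
    intro x
    rw [HeckeCharacter.inv_apply, Units.val_inv_eq_inv_val, HeckeCharacter.normCharacter_apply,
      cpow_neg_one]
  rw [h.inv_eq, HeckeCharacter.heckeLFunction_mul_eq_of_forall_apply_eq_cpow _ hn,
    heckeLFunction_galConj]
  congr 1
  ring

/-- **For a self-dual character the general root-number predicate IS the sibling's self-dual one**:
`IsRootNumber κ χ W ↔ IsSelfDualRootNumber κ χ W`. (→) `Λ′` and `Λ` are entire and agree on
`re s > 1` (`L(s + ½, χ⁻¹) = L(s − ½, χ)`), hence everywhere (identity theorem), so
`Λ(s) = WΛ(1 − s)`; (←) take `Λ′ := Λ`. [cite: Hsieh2012, Lemma 6.6 (p. 22) and Theorem A (p. 2) hypothesis (R)] -/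
theorem IsSelfDual.isRootNumber_iff [IsCMField K] {χ : HeckeCharacter K} (h : IsSelfDual χ)
    (κ : InfinitePlace K → ℕ) (W : ℂ) : IsRootNumber κ χ W ↔ IsSelfDualRootNumber κ χ W := by
  constructor
  · rintro ⟨B, hB, Λ, Λ', hΛ, hΛ', hagree, hFE⟩
    have heq : Λ' = Λ := by
      have ha : AnalyticOnNhd ℂ Λ' Set.univ := hΛ'.differentiableOn.analyticOnNhd isOpen_univ
      have hb : AnalyticOnNhd ℂ Λ Set.univ := hΛ.differentiableOn.analyticOnNhd isOpen_univ
      refine ha.eq_of_eventuallyEq hb (z₀ := 2) ?_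
      have hopen : IsOpen {s : ℂ | 1 < s.re} := isOpen_lt continuous_const Complex.continuous_re
      have hmem : (2 : ℂ) ∈ {s : ℂ | 1 < s.re} := by
        show (1 : ℝ) < (2 : ℂ).re
        norm_num
      filter_upwards [hopen.mem_nhds hmem] with s hs
      rw [(hagree s hs).2, (hagree s hs).1, h.heckeLFunction_inv_add_half]
    refine ⟨B, hB, Λ, hΛ, fun s hs ↦ (hagree s hs).1, fun s ↦ ?_⟩
    rw [hFE s, heq]
  · rintro ⟨B, hB, Λ, hΛ, hagree, hFE⟩
    refine ⟨B, hB, Λ, Λ, hΛ, hΛ, fun s hs ↦ ⟨hagree s hs, ?_⟩, hFE⟩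
    rw [hagree s hs, h.heckeLFunction_inv_add_half]

/-- **(Rm)-data give the continuation** (as (R)-data do, sibling
`IsSelfDualRootNumber.hasEntireContinuation`): from `IsRootNumber κ χ W` — an ENTIRE `Λ` with
`Λ(s) = B^s ∏_w Γ_ℂ(s + κ_w + ½) L(s − ½, χ)` on `re s > 1` — `L(s, χ)` has an entire continuation,
namely `s ↦ Λ(s + ½) B^{−(s+½)} ∏_w Γ_ℂ(s + κ_w + 1)⁻¹`. [cite: Hsieh2012, Remark 6.9 (2) (p. 24, (Rm)) and §4.1 (p. 10)]
[cite: NeukirchANT1999, Ch. VII (8.5)–(8.6)] -/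
theorem IsRootNumber.hasEntireContinuation {κ : InfinitePlace K → ℕ} {χ : HeckeCharacter K}
    {W : ℂ} (h : IsRootNumber κ χ W) :
    LFunction.HasEntireContinuation (heckeLFunction χ) := by
  obtain ⟨B, hB, Λ, Λ', hΛ, -, hagree, -⟩ := h
  have hB0 : (B : ℂ) ≠ 0 := ofReal_ne_zero.mpr hB.ne'
  have hΓ1 : ∀ s : ℂ, 1 < s.re → ∀ w : InfinitePlace K,
      Gammaℂ (s + 1 / 2 + (κ w : ℂ) + 1 / 2) ≠ 0 := by
    intro s hs w
    refine Complex.Gammaℂ_ne_zero_of_re_pos ?_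
    have h1 : (1 / 2 : ℂ) = ((1 / 2 : ℝ) : ℂ) := by push_cast; ring
    rw [h1, add_re, add_re, add_re, ofReal_re, natCast_re]
    positivity
  refine LFunction.hasEntireContinuation_of_mul_eq (Λ := fun s ↦ Λ (s + 1 / 2))
    (B := fun s ↦ (B : ℂ) ^ (-(s + 1 / 2)) *
      ∏ w : InfinitePlace K, (Gammaℂ (s + 1 / 2 + (κ w : ℂ) + 1 / 2))⁻¹)
    (hΛ.comp (differentiable_id.add_const _)) ?_ fun s hs ↦ ?_
  · refine (((differentiable_id.add_const _).neg).const_cpow (Or.inl hB0)).mul ?_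
    refine Differentiable.fun_finsetProd (𝕜 := ℂ) (𝔸' := ℂ) (u := Finset.univ)
      (f := fun w s ↦ (Gammaℂ (s + 1 / 2 + (κ w : ℂ) + 1 / 2))⁻¹) fun w _ ↦ ?_
    exact differentiable_Gammaℂ_inv.comp
      (((differentiable_id.add_const _).add_const _).add_const _)
  · have hs' : 1 < (s + 1 / 2).re := by
      have h1 : (1 / 2 : ℂ) = ((1 / 2 : ℝ) : ℂ) := by push_cast; ring
      rw [h1, add_re, ofReal_re]; linarith
    have hE : (B : ℂ) ^ (s + 1 / 2) ≠ 0 := fun h ↦ hB0 ((cpow_eq_zero_iff _ _).mp h).1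
    have hP : ∏ w : InfinitePlace K, Gammaℂ (s + 1 / 2 + (κ w : ℂ) + 1 / 2) ≠ 0 :=
      Finset.prod_ne_zero_iff.mpr fun w _ ↦ hΓ1 s hs w
    rw [(hagree _ hs').1, add_sub_cancel_right, Finset.prod_inv_distrib, cpow_neg]
    set E := (B : ℂ) ^ (s + 1 / 2)
    set P := ∏ w : InfinitePlace K, Gammaℂ (s + 1 / 2 + (κ w : ℂ) + 1 / 2)
    calc E * P * heckeLFunction χ s * (E⁻¹ * P⁻¹)
        = (E * E⁻¹) * (P * P⁻¹) * heckeLFunction χ s := by ring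
      _ = heckeLFunction χ s := by rw [mul_inv_cancel₀ hE, mul_inv_cancel₀ hP, one_mul, one_mul]

end SelfDual

/-! ### §13. Remark 6.9 (2) specialises to Theorem 6.8 -/

section API

/-- With `ν = 1` (of `p`-power order `p⁰`, unramified everywhere) Remark 6.9 (2) is Theorem 6.8 as
typed: (R) `W(χ₁*) = 1` gives (Rm) with `W = 1` through `IsSelfDual.isRootNumber_iff`
(`‖ι⁻¹(1) − 1‖ = 0 < 1`). PROVED. [cite: Hsieh2012, Remark 6.9 (2) (p. 24) and Theorem 6.8 (p. 23)] -/
theorem thmA_of_rem69_2 (h : rem69_2_NV_of_isSelfDual_mul) : thmA_NV_of_isSelfDual := by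
  intro p _ hp K _ _ _ hunr ι Sp hSp ℓ 𝔏 hℓ hℓp h𝔏 hsplit he hf χ κ hχ hsd hCp hC𝔏 hC𝔏' hL hR hC
  have h1 := h p hp K hunr ι Sp hSp ℓ 𝔏 hℓ hℓp h𝔏 hsplit he hf χ 1 κ hχ hsd ⟨0, by simp⟩
    (fun w _ ↦ by
      rw [HeckeCharacter.isUnramifiedAt_iff_forall_valued_eq_one]
      intro u _
      rfl)
  simp only [mul_one] at h1
  exact h1 hCp hC𝔏 hC𝔏' hL hC ⟨1, (hsd.isRootNumber_iff κ 1).mpr hR, by simp⟩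

end API

end Literature.NumberTheory.EllipticCurves.Hsieh2012

end
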